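import Summits.ResolutionOfSingularities.ResolutionOfSingularities.Theorems.FrobeniusLadderFInjectiveMacaulayficationT11Char7Poly
import HarnessLib

/-!
# THE `p = 5` SIBLINGS OF `T11Char7Poly.hX` / `hg0`: no variable divides a strict transform of `T₁₁`, characteristic `5`
# (crux `FrobeniusLadder.FInjectiveMacaulayfication` stmt-ResolutionOfSingularities-15315, chain w45a, road B, instance-ledger I13 = the T₁₁/5 twin;
# res-L1-w45a-plan-1 GO 2026-08-27T10:42:50Z; seat res-L1-w45a-stub-2)

[OURS · L1 W4.5a] AI-written; AI review is weaker than expert review. NOT a statement of any manuscript; no named fact.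

The road-B frame `RoadBFrame.originPointFixable_of_cells (p)` consumes, besides the p-independent fan tables and binders of
`T11Char7FanTables` / `T11Char7FanData` / `T11Char7Poly` (`G`, `SS`, `hθF₀`, `hv`, `hSScov`, … — REUSE AUDIT 2026-08-27T10:56:49Z: the p = 5
toric certificate `cert-T11-own-p5.v1.1.json` has the SAME fan, charts, `g`, `V`, `d` as the p = 7 one), the two binders `hg0`
(`g_c ≠ 0`) and `hX` (`¬ Y_i ∣ g_c`) over a field of the given characteristic; `T11Char7Poly` states them at `[CharP k 7]` through the
kernel check `hX_raw` «a `Y_i`-free term of `g_c` with coefficient class prime to 7». This file is the `p = 5` copy: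

* `hX_raw5` — for every chart `c` and variable `i`, a term of `T11Char7Poly.G c` free of `Y_i` whose coefficient class is prime to `5`
  (one `decide +kernel`; the coefficients of the strict transforms of `T₁₁ = z² + w⁷ + y⁶ + 3y⁴x³ + 3y²x⁶ + x⁹ + x¹¹` are `1` and `3`);
* `hX` — `¬ Y_i ∣ KLocCellKit.evalL k (T11Char7Poly.G c)` for `char k = 5` (`NotDvdOfSupport.forall_not_X_dvd_evalL`);
* `hg0` — `KLocCellKit.evalL k (T11Char7Poly.G c) ≠ 0` for `char k = 5`.

No definitions, no named facts. [folklore]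
-/

set_option linter.dupNamespace false

noncomputable section

namespace Summit.ResolutionOfSingularities.ResolutionOfSingularities.Theorems.FInjectiveMacaulayfication.T11Char5Poly

open MvPolynomial
open Summit.ResolutionOfSingularities.ResolutionOfSingularities.Theorems.FInjectiveMacaulayfication

/-- For every chart and variable, a term of `g_c` free of that variable whose coefficient class is prime to `5`. [folklore] -/
theorem hX_raw5 : ∀ (c : Fin 87) (i : Fin 4), ∃ t ∈ T11Char7Poly.G c, t.2 i = 0 ∧
    ¬ ((5 : ℤ) ∣ (((T11Char7Poly.G c).filter fun s : ℤ × (Fin 4 → ℕ) => s.2 = t.2).map fun s : ℤ × (Fin 4 → ℕ) => s.1).sum) := by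
  decide +kernel

/-- **`hX` at `p = 5`**: no variable divides a strict transform (`¬ Y_i ∣ g_c`; the `hX` binder of `RoadBFrame.originPointFixable_of_cells 5`). -/
theorem hX (k : Type) [Field k] [CharP k 5] : ∀ (c : Fin 87) (i : Fin 4), ¬ (X i ∣ KLocCellKit.evalL k (T11Char7Poly.G c)) := by
  intro c
  unfold KLocCellKit.evalL
  exact NotDvdOfSupport.forall_not_X_dvd_evalL 5 (T11Char7Poly.G c) (hX_raw5 c)

/-- **`hg0` at `p = 5`**: the strict transforms are non-zero. -/
theorem hg0 (k : Type) [Field k] [CharP k 5] : ∀ c : Fin 87, KLocCellKit.evalL k (T11Char7Poly.G c) ≠ 0 :=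
  fun c h => hX k c 0 (by rw [h]; exact dvd_zero _)

end Summit.ResolutionOfSingularities.ResolutionOfSingularities.Theorems.FInjectiveMacaulayfication.T11Char5Poly

end
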